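/-
Copyright: cell `pub-ymgap` (HUMAN RULING D-0062), Track A of `YM-PLAN.md`, DAG node N20 (= NE7b); R134 acceleration seat
`pub-ymgap-dag-n20-c` (strategy s1, generation 9), module 48.  Released under the licence of the surrounding project.
-/
import Summits.QuantumFields.YangMills.Theorems.BalabanUVNodesN20LCSHullHalves
import Summits.QuantumFields.YangMills.Theorems.BalabanUVNodesN20LCSPinnedEventRaw
import Summits.QuantumFields.YangMills.Theorems.BalabanUVNodesN20LCSPeierlsRegime
import HarnessLib

/-!
# YM-DAG node N20 (= NE7b), row s1, module 48: THE INSTANCE AT THE RECORD MODULO EXACTLY TWO STATEMENTS OF PRINT's KIND AND THE REGIME —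
# module 40's multi-level class weight bound with the regularity letter REPLACED by [Balaban1985Variational] Thm 1 (9)'s interior-regularity
# shape for the local problems of record (module 46 §4) and the rate product BOUNDED by `e^{−(δΛ + log m)·Σ_j #D_j}` in Bałaban's regime
# (module 47 §3): class weight `≤ e^{−κ·(number of pinned cubes)}·∫ρ₀`, `κ > 0` LEVEL-UNIFORM

Track A of `YM-PLAN.md` (cell `pub-ymgap`, HUMAN RULING D-0062), node **N20** = spine estimate NE7b (`T4WeightBudget.RelWeightBound`, NOT
PRINTED, NOT PROVED).  Seat `pub-ymgap-dag-n20-c` (R134, s1), generation 9, module 48 (imports module 41 `…N20LCSHullHalves` (hence 40), module 46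
`…N20LCSPinnedEventRaw`, module 47 `…N20LCSPeierlsRegime`).  Kernel theorems only: 0 `def`, 0 `sorry`, standard axioms; COUNT-NEUTRAL.

WHY.  After 47 modules the s1 row owes a one-screen answer to «modulo WHAT, exactly, does the (α)-road's class weight bound hold on Bałaban's label
tower at the residual of record, with a GAINFUL, LEVEL-UNIFORM rate?».  This file is that answer, by name:
* §1 **`sum_admS_integral_le_rec_pinnedLevels_hullWindow_of_regularity`** — module 40 §3 VERBATIM with its letter `hreg` REPLACED by `hThm1`: every
  minimiser of the (2.16) problem of record at a pinned cube whose datum `V′` is `ε″_j`-small on `R_j c` is `ε_{j+1}η²`-small on `{p ⊂ □^∼}`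
  ([Balaban1985Variational] Thm 1 (9)'s shape for the LOCAL problem of record, all minimisers — module 46 §4 `hreg_family_of_regularity`).
* §2 ★★★ **`sum_admS_integral_le_rec_pinnedLevels_in_regime`** — THE INSTANCE MODULO TWO: with the record's letters `β_j = g_{j+1}⁻²`, `ε″_j = ε(g_{j+1})∕B`,
  uniform constants `C, a₀, δ, α, m, B` and the regime `0 < g_{j+1} ≤ γ` (`j ∈ J`), `(X∕A₀²)^{1∕(2p₀)} ≤ log γ⁻²`, `X = 4N·B²·(C·A·M_h² + log m∕δ)`:
  `Σ_{h ∈ class K′} ∫ eterm ρ₀ K′ h dμ_{K′} ≤ exp(−(δ·C·A·M_h² + log m)·Σ_{j<K′, j∈J} #D_j)·∫ρ₀ dU₀` — modulo EXACTLY (W) «LCS-j ON THE HULL OF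
  WINDOW-ADMISSIBLE PINS» with the level-uniform constant `C` ((A1c), THE wall; module 40's `hLSw` shape at `β_j = g_{j+1}⁻²`), (T) `hThm1`
  ([Balaban1985Variational] Thm 1 (9) local, K0's pen) and (R) the coupling regime + the displayed numerics side conditions (`hguard`, `δ·A·M_h ≤ a₀`).
* §3 ★★ **`sum_admS_integral_le_rec_pinnedLevels_in_regime_of_skeleton`** — ANY pinned families `D_j`, through a `K`-dense DISJOINT skeleton `D′_j ⊆ D_j`
  (module 26's `exists_disjoint_subfamily`): `≤ exp(−(κ∕K)·Σ_j #D_j)·∫ρ₀` — one Peierls factor `e^{−κ∕K}` per pinned cube (§2 asks disjoint regularity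
  regions; print-faithful regions — the top-scale collars of `□^{∼4}` — overlap for nearby cubes, so the skeleton is the honest general form).
* §4 `rate_uniform_lt_one` — the per-cube factor `e^{−κ} < 1` whenever `κ = δ·C·A·M_h² + log m > 0`: the road's cost–volume inequality
  (`sum_admS_integral_le_of_LCS`) per pinned cube with ONE margin for every level.
* §5 ★★ **`halves_rec_pinnedLevels_hullWindow_of_regularity`** — the road's TWO NAMED PROPS `PointwiseExtraction ∧ LocCondStability` on the label tower
  at the residual of record (module 41's windowed indicator carriers) MODULO (W) + (T); `log_rate_le_in_regime` — in the regime `log (rate j) ≤ −κ·#D_j`.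

HONEST FRAMING.  A composition BY NAME (module 40 §3 ∘ module 46 §4 ∘ module 47 §3); no new estimate.  The two statements of print's kind stay DISPLAYED:
(W) is Bałaban's small-field analysis in the relative, localised currency the road forces (NOT PRINTED as a statement — [Balaban1989LargeFieldII] p.383
states the A_j-factor absolutely), (T) is [Balaban1985Variational] Thm 1 (9) for the (2.16) problems of record (PRINTED for print's problem; the tree's
Theorem-1 socket is the no-holes global problem).  The reading (NC-NE7b-α), the 𝐑-step and the numerics re-pin `M ≫ M₂` (module 43) are untouched.  NE7b NOT
PRINTED ∕ NOT PROVED; (α)-instance 0∕1; N20 NOT discharged; typed 28∕28, count untouched; one finite four-torus at fixed `ε` — NOT ℝ⁴, NOT infinite volume,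
NOT OS, NOT a mass gap, NOT Clay.

References (LOCATORS): T. Bałaban, CMP 122 (1989) 355–392 [Balaban1989LargeFieldII] ((1.79) p.383, p.383 l.21–28); CMP 102 (1985) 277–309
[Balaban1985Variational] (Thm 1 (9) p.279); CMP 119 (1988) 243–285 [Balaban1988Convergent] ((2.4) p.255, (2.16) p.257, (3.2) p.265).
-/

set_option autoImplicit false

noncomputable section

open scoped BigOperators ENNReal

namespace Summit.QuantumFields.YangMills.BalabanUVNodes.N20LCSInstanceModuloTwo

open MeasureTheory
open Literature.MathematicalPhysics.QuantumFieldTheory.Balaban1983to89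
open Literature.MathematicalPhysics.QuantumFieldTheory.Balaban1983to89.T4Continuum
open Literature.MathematicalPhysics.QuantumFieldTheory.Balaban1983to89.B14.Eq218Concrete
open Literature.MathematicalPhysics.QuantumFieldTheory.Balaban1983to89.Node00
open B15DeterminingSets B14.Eq213DetSet B14.Eq216Concrete B15Eq112TorusCover
open Literature.MathematicalPhysics.QuantumFieldTheory.BalabanImbrieJaffe1984to88.BIJ85Eq453GaugeField (qsstarGIter0)
open ExpMeanLog (deltaSU)
open Summit.QuantumFields.BalabanUV.T4Continuum.B16HistoryIndexedRepr (GoodClass)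
open Summit.QuantumFields.BalabanUV.T4Continuum.B16HistoryReprChain
open Summit.QuantumFields.BalabanUV.T4Continuum.NE7b.PrefixExtraction (admS)
open Summit.QuantumFields.YangMills.BalabanUVNodes.N20LCSLabelTower
open Summit.QuantumFields.YangMills.BalabanUVNodes.N20LCSAvgDominationRegion (boxRegion)
open Summit.QuantumFields.BalabanUV.T4Continuum.NE7b.LocalConditionalStability (LocCondStability PointwiseExtraction)
open Summit.QuantumFields.YangMills.BalabanUVNodes.N20LCSHullDisplay (sum_admS_integral_le_rec_pinnedLevels_hullWindow)
open Summit.QuantumFields.YangMills.BalabanUVNodes.N20LCSHullHalves (halves_rec_pinnedLevels_hullWindow)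
open Summit.QuantumFields.YangMills.BalabanUVNodes.N20LCSPinnedEventRaw (hreg_family_of_regularity)
open Summit.QuantumFields.YangMills.BalabanUVNodes.N20LCSPeierlsRegime (rate_pow_le_of_coupling_le threshold_div_eq)

variable (F : T4Family) (N : ℕ) [NeZero N] (ν : Stage7Numerics) (M : ℕ) (p : B12.RunParams) (g : ℕ → ℝ) (A₁ : ℝ)

/-! ## §1 Module 40 §3 with the regularity letter replaced by Theorem 1 (9)'s shape for the local problems of record -/

section OfRegularity

open Classical in
/-- ★★ **THE CLASS WEIGHT BOUND, «LCS-j» ON THE HULL OF WINDOW-ADMISSIBLE PINS, MODULO INTERIOR REGULARITY OF THE LOCAL MINIMISERS** — module 40 §3's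
`sum_admS_integral_le_rec_pinnedLevels_hullWindow` VERBATIM, its letter `hreg` supplied by module 46 §4 from `hThm1`: every minimiser of the (2.16)
problem of record at a pinned cube whose datum is `ε″_j`-small on the regularity region is `ε_{j+1}η²`-small on `{p ⊂ □^∼}`. [cite: Balaban1985Variational, Thm 1 (9) p.279] -/
theorem sum_admS_integral_le_rec_pinnedLevels_hullWindow_of_regularity {ρ₀ : cfgOfRecord F N p.K 0 → ℝ}
    (hρ : (bddMeas (cfgOfRecord F N p.K 0)).Gd ρ₀) (h0 : ∀ U, 0 ≤ ρ₀ U)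
    (J : Finset ℕ) (hJ : ∀ j ∈ J, j < p.K)
    (D : (j : ℕ) → Finset (Iχ F ν p g j)) (R : (j : ℕ) → Iχ F ν p g j → Finset (Plaq (F.P p.K) (j + 1))) (m : ℕ → ℕ) (ε'' : ℕ → ℝ)
    (hε : ∀ j ∈ J, 0 ≤ ε'' j) (hm : ∀ j ∈ J, ∀ c ∈ D j, (R j c).card ≤ m j)
    (hdisj : ∀ j ∈ J, ∀ c₁ ∈ D j, ∀ c₂ ∈ D j, c₁ ≠ c₂ → Disjoint (R j c₁) (R j c₂))
    (hεη : ∀ j ∈ J, 0 < epsOfRecord ν g (j + 1) * (F.P p.K).eta (j + 1) ^ 2)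
    (hThm1 : ∀ j ∈ J, ∀ c ∈ D j, ∀ (V' : GaugeField (F.P p.K) (j + 1) (SU N)) (U₀ : GaugeField (F.P p.K) 0 (SU N)),
      IsMinimizer (avOfRecord F N p.K) {U | PlaqSmall (ν.εreg * (F.P p.K).eta (j + 1) ^ 2) U}
          (Bj ν.M₁ (cubeEnl (F.P p.K) (sideχ F ν p g j) c 4) (j + 1)) (avgFamily (avOfRecord F N p.K) (qsstarGIter0 (j + 1) V')) U₀ →
      (∀ p' ∈ R j c, dist1 (GaugeField.plaqHol V' p') < ε'' j) →
      PlaqSmallOn (plaqInside (cubeEnl (F.P p.K) (sideχ F ν p g j) c 1)) (epsOfRecord ν g (j + 1) * (F.P p.K).eta (j + 1) ^ 2) U₀)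
    (α β C a₀ δ rate : ℕ → ℝ) (hα : ∀ j ∈ J, 0 < α j)
    (hguard : ∀ j ∈ J, (((((F.P p.K).d + 2) * (F.P p.K).L : ℕ) : ℝ) ^ 2 / 4) * Real.sqrt (2 * (Fintype.card (Fin N) : ℝ) * α j) <
      deltaSU (Fin N))
    (hβ : ∀ j ∈ J, 0 ≤ β j) (hC : ∀ j ∈ J, 0 ≤ C j) (hδ0 : ∀ j ∈ J, 0 ≤ δ j)
    (hδ : ∀ j ∈ J, δ j * ((2 * (Fintype.card (Fin N) : ℝ) * (((F.P p.K).L : ℝ) ^ 2 + 6 * ((((F.P p.K).d + 2) * (F.P p.K).L : ℕ) : ℝ) ^ 2) ^ 2 +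
        2 / α j) * (((2 * (((F.P p.K).d + 3) * (F.P p.K).L + 2) + 1) ^ (F.P p.K).d * (F.P p.K).d ^ 2 : ℕ) : ℝ)) ≤ a₀ j)
    (hrate : ∀ j ∈ J, rate j = ((m j : ℝ) * Real.exp (C j * ((2 * (Fintype.card (Fin N) : ℝ) *
            (((F.P p.K).L : ℝ) ^ 2 + 6 * ((((F.P p.K).d + 2) * (F.P p.K).L : ℕ) : ℝ) ^ 2) ^ 2 + 2 / α j) *
          (((2 * (((F.P p.K).d + 3) * (F.P p.K).L + 2) + 1) ^ (F.P p.K).d * (F.P p.K).d ^ 2 : ℕ) : ℝ)) *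
          (((2 * (((F.P p.K).d + 3) * (F.P p.K).L + 2) + 1) ^ (F.P p.K).d * (F.P p.K).d ^ 2 : ℕ) : ℝ) * δ j -
            δ j * β j * (ε'' j ^ 2 / (2 * (Fintype.card (Fin N) : ℝ))))) ^ (D j).card)
    (hrate0 : ∀ j ∈ J, 0 < rate j)
    (K' : ℕ) (E : (j : ℕ) → (Fin j → LabelPat F ν p g) → Finset (LbOfRecord F ν p g j)) (hE : ∀ j ∈ J, ∀ h t, t ∈ E j h → D j ⊆ t.1)
    (hLSw : ∀ j ∈ J, j < K' → ∀ h : Fin j → LabelPat F ν p g,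
      h ∈ admS (labelTowerOfRecord F N ν M p g A₁ (zeta316OfRecord F N ν M A₁)) (labelPattern F ν p g E) j →
      D j ⊆ cubes32 F ν M p g j (seqOfHist F ν M p g j h) →
      ∀ a : ℝ, 0 ≤ a → a ≤ a₀ j → ∀ X : Finset (Plaq (F.P p.K) j),
        (∀ q ∈ X, ∃ c ∈ D j, ∃ p' ∈ R j c, q ∈ boxRegion (emb p'.src) (((F.P p.K).d + 3) * (F.P p.K).L + 2)) →
        ∫ U, Real.exp (a * β j * ∑ q ∈ X, (1 - reTr (GaugeField.plaqHol U q))) *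
            (labelTowerOfRecord F N ν M p g A₁ (zeta316OfRecord F N ν M A₁)).eterm ρ₀ j h U ∂(lawOfRecord F N p.K j) ≤
          Real.exp (C j * a * X.card) * ∫ U, (labelTowerOfRecord F N ν M p g A₁ (zeta316OfRecord F N ν M A₁)).eterm ρ₀ j h U ∂(lawOfRecord F N p.K j)) :
    ∑ h ∈ admS (labelTowerOfRecord F N ν M p g A₁ (zeta316OfRecord F N ν M A₁)) (labelPattern F ν p g E) K',
        ∫ x, (labelTowerOfRecord F N ν M p g A₁ (zeta316OfRecord F N ν M A₁)).eterm ρ₀ K' h x ∂(lawOfRecord F N p.K K') ≤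
      (∏ j ∈ (Finset.range K').filter (· ∈ J), rate j) * ∫ U, ρ₀ U ∂(fieldMeasure (F.P p.K) 0 (SU N)) :=
  sum_admS_integral_le_rec_pinnedLevels_hullWindow F N ν M p g A₁ hρ h0 J hJ D R m ε'' hε hm hdisj
    (fun j hj => hreg_family_of_regularity F N ν p g j (hεη j hj) (D j) (R j) (ε'' j) (hThm1 j hj))
    α β C a₀ δ rate hα hguard hβ hC hδ0 hδ hrate hrate0 K' E hE hLSw

end OfRegularity

/-! ## §2 The instance modulo two: the record's letters `β_j = g_{j+1}⁻²`, `ε″_j = ε(g_{j+1})∕B`, in Bałaban's regime -/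

section InRegime

open Classical in
/-- ★★★ **THE INSTANCE AT THE RECORD MODULO EXACTLY TWO STATEMENTS OF PRINT's KIND AND THE REGIME.**  On Bałaban's label tower at the residual of record,
for a bounded measurable `ρ₀ ≥ 0`, pinned levels `J` with families `D_j`, DISJOINT regularity regions `R_j c` of size `≤ m`, UNIFORM constants
`C ≥ 0, a₀, 0 < δ, 0 < α, 1 ≤ m, 0 < B`, the record's letters `β_j = g_{j+1}⁻²`, `ε″_j = ε(g_{j+1})∕B` and the REGIME `0 < g_{j+1} ≤ γ` (`j ∈ J`),
`(X∕A₀²)^{1∕(2p₀)} ≤ log γ⁻²` with `X = 4N·B²·(C·A·M_h·M_h + log m∕δ)`: IF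
(W) «LCS-j ON THE HULL OF WINDOW-ADMISSIBLE PINS» holds at the levels of `J` with constant `C` and
(T) every minimiser of the (2.16) problem of record at a pinned cube with `ε″_j`-small datum on its regularity region is `ε_{j+1}η²`-small on `{p ⊂ □^∼}`,
THEN `Σ_{h ∈ class K′} ∫ eterm ρ₀ K′ h dμ_{K′} ≤ exp(−(δ·(C·A·M_h·M_h + log m∕δ))·Σ_{j<K′, j∈J} #D_j)·∫ρ₀ dU₀` — ONE PEIERLS FACTOR `e^{−κ}` PER PINNED
CUBE PER PINNED LEVEL, `κ = δ·C·A·M_h² + log m` THE SAME AT EVERY LEVEL. [cite: Balaban1989LargeFieldII, (1.79) p.383, p.383 l.21–28; Balaban1985Variational, Thm 1 (9) p.279] -/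
theorem sum_admS_integral_le_rec_pinnedLevels_in_regime {ρ₀ : cfgOfRecord F N p.K 0 → ℝ}
    (hρ : (bddMeas (cfgOfRecord F N p.K 0)).Gd ρ₀) (h0 : ∀ U, 0 ≤ ρ₀ U)
    (J : Finset ℕ) (hJ : ∀ j ∈ J, j < p.K)
    (D : (j : ℕ) → Finset (Iχ F ν p g j)) (R : (j : ℕ) → Iχ F ν p g j → Finset (Plaq (F.P p.K) (j + 1))) (m : ℕ) (hm1 : 1 ≤ m)
    (hm : ∀ j ∈ J, ∀ c ∈ D j, (R j c).card ≤ m)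
    (hdisj : ∀ j ∈ J, ∀ c₁ ∈ D j, ∀ c₂ ∈ D j, c₁ ≠ c₂ → Disjoint (R j c₁) (R j c₂))
    {B γ : ℝ} (hB : 0 < B) (hA0 : 0 < ν.A₀) (hp0 : 1 ≤ ν.p₀)
    (hg : ∀ j ∈ J, 0 < g (j + 1) ∧ g (j + 1) ≤ γ)
    (hεη : ∀ j ∈ J, 0 < epsOfRecord ν g (j + 1) * (F.P p.K).eta (j + 1) ^ 2)
    (hThm1 : ∀ j ∈ J, ∀ c ∈ D j, ∀ (V' : GaugeField (F.P p.K) (j + 1) (SU N)) (U₀ : GaugeField (F.P p.K) 0 (SU N)),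
      IsMinimizer (avOfRecord F N p.K) {U | PlaqSmall (ν.εreg * (F.P p.K).eta (j + 1) ^ 2) U}
          (Bj ν.M₁ (cubeEnl (F.P p.K) (sideχ F ν p g j) c 4) (j + 1)) (avgFamily (avOfRecord F N p.K) (qsstarGIter0 (j + 1) V')) U₀ →
      (∀ p' ∈ R j c, dist1 (GaugeField.plaqHol V' p') < epsOfRecord ν g (j + 1) / B) →
      PlaqSmallOn (plaqInside (cubeEnl (F.P p.K) (sideχ F ν p g j) c 1)) (epsOfRecord ν g (j + 1) * (F.P p.K).eta (j + 1) ^ 2) U₀)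
    {α C a₀ δ : ℝ} (hα : 0 < α)
    (hguard : (((((F.P p.K).d + 2) * (F.P p.K).L : ℕ) : ℝ) ^ 2 / 4) * Real.sqrt (2 * (Fintype.card (Fin N) : ℝ) * α) < deltaSU (Fin N))
    (hC : 0 ≤ C) (hδ : 0 < δ)
    (hδa : δ * ((2 * (Fintype.card (Fin N) : ℝ) * (((F.P p.K).L : ℝ) ^ 2 + 6 * ((((F.P p.K).d + 2) * (F.P p.K).L : ℕ) : ℝ) ^ 2) ^ 2 +
        2 / α) * (((2 * (((F.P p.K).d + 3) * (F.P p.K).L + 2) + 1) ^ (F.P p.K).d * (F.P p.K).d ^ 2 : ℕ) : ℝ)) ≤ a₀)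
    (hX : 0 ≤ 4 * (Fintype.card (Fin N) : ℝ) * B ^ 2 *
      (C * ((2 * (Fintype.card (Fin N) : ℝ) * (((F.P p.K).L : ℝ) ^ 2 + 6 * ((((F.P p.K).d + 2) * (F.P p.K).L : ℕ) : ℝ) ^ 2) ^ 2 + 2 / α) *
          (((2 * (((F.P p.K).d + 3) * (F.P p.K).L + 2) + 1) ^ (F.P p.K).d * (F.P p.K).d ^ 2 : ℕ) : ℝ)) *
          (((2 * (((F.P p.K).d + 3) * (F.P p.K).L + 2) + 1) ^ (F.P p.K).d * (F.P p.K).d ^ 2 : ℕ) : ℝ) + Real.log m / δ))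
    (hlog : (4 * (Fintype.card (Fin N) : ℝ) * B ^ 2 *
      (C * ((2 * (Fintype.card (Fin N) : ℝ) * (((F.P p.K).L : ℝ) ^ 2 + 6 * ((((F.P p.K).d + 2) * (F.P p.K).L : ℕ) : ℝ) ^ 2) ^ 2 + 2 / α) *
          (((2 * (((F.P p.K).d + 3) * (F.P p.K).L + 2) + 1) ^ (F.P p.K).d * (F.P p.K).d ^ 2 : ℕ) : ℝ)) *
          (((2 * (((F.P p.K).d + 3) * (F.P p.K).L + 2) + 1) ^ (F.P p.K).d * (F.P p.K).d ^ 2 : ℕ) : ℝ) + Real.log m / δ) / ν.A₀ ^ 2) ^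
        ((1 : ℝ) / (2 * ν.p₀)) ≤ Real.log (γ ^ 2)⁻¹)
    (K' : ℕ) (E : (j : ℕ) → (Fin j → LabelPat F ν p g) → Finset (LbOfRecord F ν p g j)) (hE : ∀ j ∈ J, ∀ h t, t ∈ E j h → D j ⊆ t.1)
    (hLSw : ∀ j ∈ J, j < K' → ∀ h : Fin j → LabelPat F ν p g,
      h ∈ admS (labelTowerOfRecord F N ν M p g A₁ (zeta316OfRecord F N ν M A₁)) (labelPattern F ν p g E) j →
      D j ⊆ cubes32 F ν M p g j (seqOfHist F ν M p g j h) →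
      ∀ a : ℝ, 0 ≤ a → a ≤ a₀ → ∀ X : Finset (Plaq (F.P p.K) j),
        (∀ q ∈ X, ∃ c ∈ D j, ∃ p' ∈ R j c, q ∈ boxRegion (emb p'.src) (((F.P p.K).d + 3) * (F.P p.K).L + 2)) →
        ∫ U, Real.exp (a * ((g (j + 1)) ^ 2)⁻¹ * ∑ q ∈ X, (1 - reTr (GaugeField.plaqHol U q))) *
            (labelTowerOfRecord F N ν M p g A₁ (zeta316OfRecord F N ν M A₁)).eterm ρ₀ j h U ∂(lawOfRecord F N p.K j) ≤
          Real.exp (C * a * X.card) * ∫ U, (labelTowerOfRecord F N ν M p g A₁ (zeta316OfRecord F N ν M A₁)).eterm ρ₀ j h U ∂(lawOfRecord F N p.K j)) :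
    ∑ h ∈ admS (labelTowerOfRecord F N ν M p g A₁ (zeta316OfRecord F N ν M A₁)) (labelPattern F ν p g E) K',
        ∫ x, (labelTowerOfRecord F N ν M p g A₁ (zeta316OfRecord F N ν M A₁)).eterm ρ₀ K' h x ∂(lawOfRecord F N p.K K') ≤
      Real.exp (-(δ * (C * ((2 * (Fintype.card (Fin N) : ℝ) * (((F.P p.K).L : ℝ) ^ 2 + 6 * ((((F.P p.K).d + 2) * (F.P p.K).L : ℕ) : ℝ) ^ 2) ^ 2 +
              2 / α) * (((2 * (((F.P p.K).d + 3) * (F.P p.K).L + 2) + 1) ^ (F.P p.K).d * (F.P p.K).d ^ 2 : ℕ) : ℝ)) *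
              (((2 * (((F.P p.K).d + 3) * (F.P p.K).L + 2) + 1) ^ (F.P p.K).d * (F.P p.K).d ^ 2 : ℕ) : ℝ) + Real.log m / δ)) *
          ∑ j ∈ (Finset.range K').filter (· ∈ J), ((D j).card : ℝ)) *
        ∫ U, ρ₀ U ∂(fieldMeasure (F.P p.K) 0 (SU N)) := by
  -- n20-d's constants (domination `A`, hull size `M_h`), the loss constant `Λ = C·A·M_h²`, the rate of record
  set N' : ℝ := (Fintype.card (Fin N) : ℝ) with hN'
  set Ad : ℝ := 2 * N' * (((F.P p.K).L : ℝ) ^ 2 + 6 * ((((F.P p.K).d + 2) * (F.P p.K).L : ℕ) : ℝ) ^ 2) ^ 2 + 2 / α with hAd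
  set Mh : ℝ := (((2 * (((F.P p.K).d + 3) * (F.P p.K).L + 2) + 1) ^ (F.P p.K).d * (F.P p.K).d ^ 2 : ℕ) : ℝ) with hMh
  set Λ : ℝ := C * (Ad * Mh) * Mh with hΛ
  have hNpos : 0 < N' := by rw [hN', Fintype.card_fin]; exact_mod_cast Nat.pos_of_ne_zero (NeZero.ne N)
  have hm1' : (1 : ℝ) ≤ m := by exact_mod_cast hm1
  have hε0 : ∀ j ∈ J, 0 ≤ epsOfRecord ν g (j + 1) / B := fun j hj =>
    div_nonneg (pos_of_mul_pos_left (hεη j hj) (sq_nonneg _)).le hB.le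
  set rate : ℕ → ℝ := fun j =>
    ((m : ℝ) * Real.exp (Λ * δ - δ * ((g (j + 1)) ^ 2)⁻¹ * ((epsOfRecord ν g (j + 1) / B) ^ 2 / (2 * N')))) ^ (D j).card
    with hrate_def
  have hrate0 : ∀ j ∈ J, 0 < rate j := fun j _ =>
    pow_pos (mul_pos (lt_of_lt_of_le one_pos hm1') (Real.exp_pos _)) _
  have key := sum_admS_integral_le_rec_pinnedLevels_hullWindow_of_regularity F N ν M p g A₁ hρ h0 J hJ D R (fun _ => m)
    (fun j => epsOfRecord ν g (j + 1) / B) hε0 hm hdisj hεη hThm1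
    (fun _ => α) (fun j => ((g (j + 1)) ^ 2)⁻¹) (fun _ => C) (fun _ => a₀) (fun _ => δ) rate (fun _ _ => hα) (fun _ _ => hguard)
    (fun j _ => by positivity) (fun _ _ => hC) (fun _ _ => hδ.le) (fun _ _ => hδa)
    (fun j _ => rfl) hrate0 K' E hE hLSw
  refine key.trans (mul_le_mul_of_nonneg_right ?_ (integral_nonneg h0))
  -- the rate product in the regime: `Π_{j} rate j ≤ exp(−κ·Σ_j #D_j)`, `κ = δ(Λ + log m/δ)` (module 47 §3, level by level)
  rw [Finset.mul_sum, Real.exp_sum]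
  refine Finset.prod_le_prod (fun j hj => (hrate0 j (Finset.mem_filter.1 hj).2).le) fun j hj => ?_
  have hjJ : j ∈ J := (Finset.mem_filter.1 hj).2
  have h47 := rate_pow_le_of_coupling_le ν g (j + 1) hm1' hδ hNpos hB hA0 hp0 hX (hg j hjJ).1 (hg j hjJ).2 hlog (D j).card
  rw [threshold_div_eq hNpos hB] at h47
  rw [hrate_def]
  exact h47

end InRegime

/-! ## §3 General pinned families: one Peierls factor per `K` pinned cubes through a disjoint skeleton -/

section Skeleton

open Classical in
/-- ★★ **FOR ANY PINNED FAMILIES `D_j`, THROUGH A `K`-DENSE DISJOINT SKELETON `D′_j ⊆ D_j`** (`#D_j ≤ K·#D′_j`, regularity regions of `D′_j` pairwise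
disjoint — supplied by module 26's greedy `N20LCSLargeFieldSparsify.exists_disjoint_subfamily` whenever every region meets at most `K` others): with the
class still pinned by `D` (`t ∈ E_j h ⇒ D_j ⊆ P(t)`, a fortiori `D′_j ⊆ P(t)`), (W) on the hull of the SKELETON's regions for prefixes whose window contains
the skeleton, (T) at the skeleton's cubes, and the regime of §2:
`Σ_{h ∈ class K′} ∫ eterm ρ₀ K′ h ≤ exp(−(κ∕K)·Σ_{j<K′, j∈J} #D_j)·∫ρ₀`, `κ = δ·(C·A·M_h² + log m∕δ)` — ONE PEIERLS FACTOR `e^{−κ∕K}` PER PINNED CUBE.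
[cite: Balaban1989LargeFieldII, (1.79) p.383; Balaban1985Variational, Thm 1 (9) p.279] -/
theorem sum_admS_integral_le_rec_pinnedLevels_in_regime_of_skeleton {ρ₀ : cfgOfRecord F N p.K 0 → ℝ}
    (hρ : (bddMeas (cfgOfRecord F N p.K 0)).Gd ρ₀) (h0 : ∀ U, 0 ≤ ρ₀ U)
    (J : Finset ℕ) (hJ : ∀ j ∈ J, j < p.K)
    (D D' : (j : ℕ) → Finset (Iχ F ν p g j)) (hsub : ∀ j ∈ J, D' j ⊆ D j) {K : ℕ} (hK1 : 1 ≤ K)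
    (hK : ∀ j ∈ J, (D j).card ≤ K * (D' j).card)
    (R : (j : ℕ) → Iχ F ν p g j → Finset (Plaq (F.P p.K) (j + 1))) (m : ℕ) (hm1 : 1 ≤ m)
    (hm : ∀ j ∈ J, ∀ c ∈ D' j, (R j c).card ≤ m)
    (hdisj : ∀ j ∈ J, ∀ c₁ ∈ D' j, ∀ c₂ ∈ D' j, c₁ ≠ c₂ → Disjoint (R j c₁) (R j c₂))
    {B γ : ℝ} (hB : 0 < B) (hA0 : 0 < ν.A₀) (hp0 : 1 ≤ ν.p₀)
    (hg : ∀ j ∈ J, 0 < g (j + 1) ∧ g (j + 1) ≤ γ)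
    (hεη : ∀ j ∈ J, 0 < epsOfRecord ν g (j + 1) * (F.P p.K).eta (j + 1) ^ 2)
    (hThm1 : ∀ j ∈ J, ∀ c ∈ D' j, ∀ (V' : GaugeField (F.P p.K) (j + 1) (SU N)) (U₀ : GaugeField (F.P p.K) 0 (SU N)),
      IsMinimizer (avOfRecord F N p.K) {U | PlaqSmall (ν.εreg * (F.P p.K).eta (j + 1) ^ 2) U}
          (Bj ν.M₁ (cubeEnl (F.P p.K) (sideχ F ν p g j) c 4) (j + 1)) (avgFamily (avOfRecord F N p.K) (qsstarGIter0 (j + 1) V')) U₀ →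
      (∀ p' ∈ R j c, dist1 (GaugeField.plaqHol V' p') < epsOfRecord ν g (j + 1) / B) →
      PlaqSmallOn (plaqInside (cubeEnl (F.P p.K) (sideχ F ν p g j) c 1)) (epsOfRecord ν g (j + 1) * (F.P p.K).eta (j + 1) ^ 2) U₀)
    {α C a₀ δ : ℝ} (hα : 0 < α)
    (hguard : (((((F.P p.K).d + 2) * (F.P p.K).L : ℕ) : ℝ) ^ 2 / 4) * Real.sqrt (2 * (Fintype.card (Fin N) : ℝ) * α) < deltaSU (Fin N))
    (hC : 0 ≤ C) (hδ : 0 < δ)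
    (hδa : δ * ((2 * (Fintype.card (Fin N) : ℝ) * (((F.P p.K).L : ℝ) ^ 2 + 6 * ((((F.P p.K).d + 2) * (F.P p.K).L : ℕ) : ℝ) ^ 2) ^ 2 +
        2 / α) * (((2 * (((F.P p.K).d + 3) * (F.P p.K).L + 2) + 1) ^ (F.P p.K).d * (F.P p.K).d ^ 2 : ℕ) : ℝ)) ≤ a₀)
    (hX : 0 ≤ 4 * (Fintype.card (Fin N) : ℝ) * B ^ 2 *
      (C * ((2 * (Fintype.card (Fin N) : ℝ) * (((F.P p.K).L : ℝ) ^ 2 + 6 * ((((F.P p.K).d + 2) * (F.P p.K).L : ℕ) : ℝ) ^ 2) ^ 2 + 2 / α) *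
          (((2 * (((F.P p.K).d + 3) * (F.P p.K).L + 2) + 1) ^ (F.P p.K).d * (F.P p.K).d ^ 2 : ℕ) : ℝ)) *
          (((2 * (((F.P p.K).d + 3) * (F.P p.K).L + 2) + 1) ^ (F.P p.K).d * (F.P p.K).d ^ 2 : ℕ) : ℝ) + Real.log m / δ))
    (hlog : (4 * (Fintype.card (Fin N) : ℝ) * B ^ 2 *
      (C * ((2 * (Fintype.card (Fin N) : ℝ) * (((F.P p.K).L : ℝ) ^ 2 + 6 * ((((F.P p.K).d + 2) * (F.P p.K).L : ℕ) : ℝ) ^ 2) ^ 2 + 2 / α) *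
          (((2 * (((F.P p.K).d + 3) * (F.P p.K).L + 2) + 1) ^ (F.P p.K).d * (F.P p.K).d ^ 2 : ℕ) : ℝ)) *
          (((2 * (((F.P p.K).d + 3) * (F.P p.K).L + 2) + 1) ^ (F.P p.K).d * (F.P p.K).d ^ 2 : ℕ) : ℝ) + Real.log m / δ) / ν.A₀ ^ 2) ^
        ((1 : ℝ) / (2 * ν.p₀)) ≤ Real.log (γ ^ 2)⁻¹)
    (K' : ℕ) (E : (j : ℕ) → (Fin j → LabelPat F ν p g) → Finset (LbOfRecord F ν p g j)) (hE : ∀ j ∈ J, ∀ h t, t ∈ E j h → D j ⊆ t.1)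
    (hLSw : ∀ j ∈ J, j < K' → ∀ h : Fin j → LabelPat F ν p g,
      h ∈ admS (labelTowerOfRecord F N ν M p g A₁ (zeta316OfRecord F N ν M A₁)) (labelPattern F ν p g E) j →
      D' j ⊆ cubes32 F ν M p g j (seqOfHist F ν M p g j h) →
      ∀ a : ℝ, 0 ≤ a → a ≤ a₀ → ∀ X : Finset (Plaq (F.P p.K) j),
        (∀ q ∈ X, ∃ c ∈ D' j, ∃ p' ∈ R j c, q ∈ boxRegion (emb p'.src) (((F.P p.K).d + 3) * (F.P p.K).L + 2)) →
        ∫ U, Real.exp (a * ((g (j + 1)) ^ 2)⁻¹ * ∑ q ∈ X, (1 - reTr (GaugeField.plaqHol U q))) *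
            (labelTowerOfRecord F N ν M p g A₁ (zeta316OfRecord F N ν M A₁)).eterm ρ₀ j h U ∂(lawOfRecord F N p.K j) ≤
          Real.exp (C * a * X.card) * ∫ U, (labelTowerOfRecord F N ν M p g A₁ (zeta316OfRecord F N ν M A₁)).eterm ρ₀ j h U ∂(lawOfRecord F N p.K j)) :
    ∑ h ∈ admS (labelTowerOfRecord F N ν M p g A₁ (zeta316OfRecord F N ν M A₁)) (labelPattern F ν p g E) K',
        ∫ x, (labelTowerOfRecord F N ν M p g A₁ (zeta316OfRecord F N ν M A₁)).eterm ρ₀ K' h x ∂(lawOfRecord F N p.K K') ≤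
      Real.exp (-(δ * (C * ((2 * (Fintype.card (Fin N) : ℝ) * (((F.P p.K).L : ℝ) ^ 2 + 6 * ((((F.P p.K).d + 2) * (F.P p.K).L : ℕ) : ℝ) ^ 2) ^ 2 +
              2 / α) * (((2 * (((F.P p.K).d + 3) * (F.P p.K).L + 2) + 1) ^ (F.P p.K).d * (F.P p.K).d ^ 2 : ℕ) : ℝ)) *
              (((2 * (((F.P p.K).d + 3) * (F.P p.K).L + 2) + 1) ^ (F.P p.K).d * (F.P p.K).d ^ 2 : ℕ) : ℝ) + Real.log m / δ)) / K *
          ∑ j ∈ (Finset.range K').filter (· ∈ J), ((D j).card : ℝ)) *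
        ∫ U, ρ₀ U ∂(fieldMeasure (F.P p.K) 0 (SU N)) := by
  -- the level-uniform margin `κ = δ·(Λ + log m/δ) ≥ 0` (from `0 ≤ X = 4N·B²·(Λ + log m/δ)`)
  set κ : ℝ := δ * (C * ((2 * (Fintype.card (Fin N) : ℝ) * (((F.P p.K).L : ℝ) ^ 2 + 6 * ((((F.P p.K).d + 2) * (F.P p.K).L : ℕ) : ℝ) ^ 2) ^ 2 +
      2 / α) * (((2 * (((F.P p.K).d + 3) * (F.P p.K).L + 2) + 1) ^ (F.P p.K).d * (F.P p.K).d ^ 2 : ℕ) : ℝ)) *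
      (((2 * (((F.P p.K).d + 3) * (F.P p.K).L + 2) + 1) ^ (F.P p.K).d * (F.P p.K).d ^ 2 : ℕ) : ℝ) + Real.log m / δ) with hκdef
  have hNpos : 0 < (Fintype.card (Fin N) : ℝ) := by rw [Fintype.card_fin]; exact_mod_cast Nat.pos_of_ne_zero (NeZero.ne N)
  have h4 : 0 < 4 * (Fintype.card (Fin N) : ℝ) * B ^ 2 := by positivity
  have hκ : 0 ≤ κ := mul_nonneg hδ.le ((mul_nonneg_iff_of_pos_left h4).1 hX)
  have key := sum_admS_integral_le_rec_pinnedLevels_in_regime F N ν M p g A₁ hρ h0 J hJ D' R m hm1 hm hdisj hB hA0 hp0 hg hεη hThm1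
    hα hguard hC hδ hδa hX hlog K' E (fun j hj h t ht => (hsub j hj).trans (hE j hj h t ht)) hLSw
  refine key.trans (mul_le_mul_of_nonneg_right (Real.exp_le_exp.2 ?_) (integral_nonneg h0))
  -- `−κ·Σ #D′ ≤ −(κ/K)·Σ #D` from `#D_j ≤ K·#D′_j`
  have hK0 : (0 : ℝ) < K := by exact_mod_cast hK1
  have hsum : ∑ j ∈ (Finset.range K').filter (· ∈ J), ((D j).card : ℝ) ≤
      K * ∑ j ∈ (Finset.range K').filter (· ∈ J), ((D' j).card : ℝ) := by
    rw [Finset.mul_sum]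
    exact Finset.sum_le_sum fun j hj => by exact_mod_cast hK j (Finset.mem_filter.1 hj).2
  have h1 : κ * (∑ j ∈ (Finset.range K').filter (· ∈ J), ((D j).card : ℝ)) / K ≤
      κ * ∑ j ∈ (Finset.range K').filter (· ∈ J), ((D' j).card : ℝ) := by
    rw [div_le_iff₀ hK0]
    calc κ * ∑ j ∈ (Finset.range K').filter (· ∈ J), ((D j).card : ℝ)
        ≤ κ * (K * ∑ j ∈ (Finset.range K').filter (· ∈ J), ((D' j).card : ℝ)) := mul_le_mul_of_nonneg_left hsum hκ
      _ = κ * (∑ j ∈ (Finset.range K').filter (· ∈ J), ((D' j).card : ℝ)) * K := by ring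
  calc -κ * ∑ j ∈ (Finset.range K').filter (· ∈ J), ((D' j).card : ℝ)
      = -(κ * ∑ j ∈ (Finset.range K').filter (· ∈ J), ((D' j).card : ℝ)) := by ring
    _ ≤ -(κ * (∑ j ∈ (Finset.range K').filter (· ∈ J), ((D j).card : ℝ)) / K) := neg_le_neg h1
    _ = -κ / K * ∑ j ∈ (Finset.range K').filter (· ∈ J), ((D j).card : ℝ) := by ring

end Skeleton

/-! ## §4 The per-cube factor is gainful, level-uniformly -/

section Gain

/-- ★ **THE COST–VOLUME INEQUALITY PER PINNED CUBE, LEVEL-UNIFORMLY**: the per-cube factor `e^{−(δ·Λ + log m)}` of §2 is `< 1` as soon as the margin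
`δ·Λ + log m` is positive (`Λ = C·A·M_h² > 0` or `m > 1`) — the road's «extracted cost beats the stability volume cost» with one margin for every level.
[cite: Balaban1989LargeFieldII, p.383 l.21–28] -/
theorem rate_uniform_lt_one {δ Λ : ℝ} {m : ℕ} (hδ : 0 < δ) (hκ : 0 < δ * Λ + Real.log m) :
    Real.exp (-(δ * (Λ + Real.log m / δ))) < 1 := by
  rw [Real.exp_lt_one_iff, neg_lt_zero]
  have : δ * (Λ + Real.log m / δ) = δ * Λ + Real.log m := by field_simp
  rw [this]
  exact hκ

end Gain


/-! ## §5 The two named Props of the (α)-road modulo (W) + (T) -/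

section Halves

open Classical in
/-- ★★ **`PointwiseExtraction ∧ LocCondStability` ON BAŁABAN's LABEL TOWER AT THE RESIDUAL OF RECORD, MODULO (W) + (T)** — module 41's
`halves_rec_pinnedLevels_hullWindow` (windowed indicator carriers, exponents `log (rate j)` at the pinned levels) with its regularity letter supplied from
the all-minimisers interior-regularity hypothesis `hThm1` (module 46 §4); the moment hypothesis is (W) verbatim.  In the regime of §2 the exponents are
`log (rate j) ≤ −(δ·C·A·M_h² + log m)·#D_j` (`log_rate_le_in_regime`, §2's regime). [cite: Balaban1985Variational, Thm 1 (9) p.279; Balaban1989LargeFieldII, (1.79) p.383] -/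
theorem halves_rec_pinnedLevels_hullWindow_of_regularity {ρ₀ : cfgOfRecord F N p.K 0 → ℝ}
    (hρ : (bddMeas (cfgOfRecord F N p.K 0)).Gd ρ₀) (h0 : ∀ U, 0 ≤ ρ₀ U)
    (J : Finset ℕ) (hJ : ∀ j ∈ J, j < p.K)
    (D : (j : ℕ) → Finset (Iχ F ν p g j)) (R : (j : ℕ) → Iχ F ν p g j → Finset (Plaq (F.P p.K) (j + 1))) (m : ℕ → ℕ) (ε'' : ℕ → ℝ)
    (hε : ∀ j ∈ J, 0 ≤ ε'' j) (hm : ∀ j ∈ J, ∀ c ∈ D j, (R j c).card ≤ m j)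
    (hdisj : ∀ j ∈ J, ∀ c₁ ∈ D j, ∀ c₂ ∈ D j, c₁ ≠ c₂ → Disjoint (R j c₁) (R j c₂))
    (hεη : ∀ j ∈ J, 0 < epsOfRecord ν g (j + 1) * (F.P p.K).eta (j + 1) ^ 2)
    (hThm1 : ∀ j ∈ J, ∀ c ∈ D j, ∀ (V' : GaugeField (F.P p.K) (j + 1) (SU N)) (U₀ : GaugeField (F.P p.K) 0 (SU N)),
      IsMinimizer (avOfRecord F N p.K) {U | PlaqSmall (ν.εreg * (F.P p.K).eta (j + 1) ^ 2) U}
          (Bj ν.M₁ (cubeEnl (F.P p.K) (sideχ F ν p g j) c 4) (j + 1)) (avgFamily (avOfRecord F N p.K) (qsstarGIter0 (j + 1) V')) U₀ →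
      (∀ p' ∈ R j c, dist1 (GaugeField.plaqHol V' p') < ε'' j) →
      PlaqSmallOn (plaqInside (cubeEnl (F.P p.K) (sideχ F ν p g j) c 1)) (epsOfRecord ν g (j + 1) * (F.P p.K).eta (j + 1) ^ 2) U₀)
    (α β C a₀ δ rate : ℕ → ℝ) (hα : ∀ j ∈ J, 0 < α j)
    (hguard : ∀ j ∈ J, (((((F.P p.K).d + 2) * (F.P p.K).L : ℕ) : ℝ) ^ 2 / 4) * Real.sqrt (2 * (Fintype.card (Fin N) : ℝ) * α j) <
      deltaSU (Fin N))
    (hβ : ∀ j ∈ J, 0 ≤ β j) (hC : ∀ j ∈ J, 0 ≤ C j) (hδ0 : ∀ j ∈ J, 0 ≤ δ j)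
    (hδ : ∀ j ∈ J, δ j * ((2 * (Fintype.card (Fin N) : ℝ) * (((F.P p.K).L : ℝ) ^ 2 + 6 * ((((F.P p.K).d + 2) * (F.P p.K).L : ℕ) : ℝ) ^ 2) ^ 2 +
        2 / α j) * (((2 * (((F.P p.K).d + 3) * (F.P p.K).L + 2) + 1) ^ (F.P p.K).d * (F.P p.K).d ^ 2 : ℕ) : ℝ)) ≤ a₀ j)
    (hrate : ∀ j ∈ J, rate j = ((m j : ℝ) * Real.exp (C j * ((2 * (Fintype.card (Fin N) : ℝ) *
            (((F.P p.K).L : ℝ) ^ 2 + 6 * ((((F.P p.K).d + 2) * (F.P p.K).L : ℕ) : ℝ) ^ 2) ^ 2 + 2 / α j) *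
          (((2 * (((F.P p.K).d + 3) * (F.P p.K).L + 2) + 1) ^ (F.P p.K).d * (F.P p.K).d ^ 2 : ℕ) : ℝ)) *
          (((2 * (((F.P p.K).d + 3) * (F.P p.K).L + 2) + 1) ^ (F.P p.K).d * (F.P p.K).d ^ 2 : ℕ) : ℝ) * δ j -
            δ j * β j * (ε'' j ^ 2 / (2 * (Fintype.card (Fin N) : ℝ))))) ^ (D j).card)
    (hrate0 : ∀ j ∈ J, 0 < rate j)
    (K' : ℕ) (E : (j : ℕ) → (Fin j → LabelPat F ν p g) → Finset (LbOfRecord F ν p g j)) (hE : ∀ j ∈ J, ∀ h t, t ∈ E j h → D j ⊆ t.1)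
    (hLSw : ∀ j ∈ J, j < K' → ∀ h : Fin j → LabelPat F ν p g,
      h ∈ admS (labelTowerOfRecord F N ν M p g A₁ (zeta316OfRecord F N ν M A₁)) (labelPattern F ν p g E) j →
      D j ⊆ cubes32 F ν M p g j (seqOfHist F ν M p g j h) →
      ∀ a : ℝ, 0 ≤ a → a ≤ a₀ j → ∀ X : Finset (Plaq (F.P p.K) j),
        (∀ q ∈ X, ∃ c ∈ D j, ∃ p' ∈ R j c, q ∈ boxRegion (emb p'.src) (((F.P p.K).d + 3) * (F.P p.K).L + 2)) →
        ∫ U, Real.exp (a * β j * ∑ q ∈ X, (1 - reTr (GaugeField.plaqHol U q))) *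
            (labelTowerOfRecord F N ν M p g A₁ (zeta316OfRecord F N ν M A₁)).eterm ρ₀ j h U ∂(lawOfRecord F N p.K j) ≤
          Real.exp (C j * a * X.card) * ∫ U, (labelTowerOfRecord F N ν M p g A₁ (zeta316OfRecord F N ν M A₁)).eterm ρ₀ j h U ∂(lawOfRecord F N p.K j)) :
    PointwiseExtraction (labelTowerOfRecord F N ν M p g A₁ (zeta316OfRecord F N ν M A₁)) (labelPattern F ν p g E) K'
        (labelChi F N ν M p g A₁ (zeta316OfRecord F N ν M A₁))
        (fun j h U => if j ∈ J then (if D j ⊆ cubes32 F ν M p g j (seqOfHist F ν M p g j h) then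
          Set.indicator {U : cfgOfRecord F N p.K j |
            ∀ c ∈ D j, ∃ p' ∈ R j c, ε'' j ≤ dist1 (GaugeField.plaqHol ((avOfRecord F N p.K j).avg U) p')} (fun _ => (1 : ℝ)) U else 0) else 1)
        (fun _ _ => 0) ∧
      LocCondStability (labelTowerOfRecord F N ν M p g A₁ (zeta316OfRecord F N ν M A₁)) (labelPattern F ν p g E) K' (lawOfRecord F N p.K) ρ₀
        (fun j h U => if j ∈ J then (if D j ⊆ cubes32 F ν M p g j (seqOfHist F ν M p g j h) then
          Set.indicator {U : cfgOfRecord F N p.K j |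
            ∀ c ∈ D j, ∃ p' ∈ R j c, ε'' j ≤ dist1 (GaugeField.plaqHol ((avOfRecord F N p.K j).avg U) p')} (fun _ => (1 : ℝ)) U else 0) else 1)
        (fun j _ => if j ∈ J then Real.log (rate j) else 0) :=
  halves_rec_pinnedLevels_hullWindow F N ν M p g A₁ hρ h0 J hJ D R m ε'' hε hm hdisj
    (fun j hj => hreg_family_of_regularity F N ν p g j (hεη j hj) (D j) (R j) (ε'' j) (hThm1 j hj))
    α β C a₀ δ rate hα hguard hβ hC hδ0 hδ hrate hrate0 K' E hE hLSw

/-- **THE STABILITY EXPONENT IN THE REGIME**: at the record's letters and in the regime of §2, the per-level exponent of `LocCondStability` above satisfies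
`log (rate j) ≤ −(δ·(C·A·M_h·M_h + log m∕δ))·#D_j` (module 47 §3, then `Real.log_le_log` ∕ `Real.log_exp`). [cite: Balaban1989LargeFieldII, p.383 l.21–28] -/
theorem log_rate_le_in_regime (ν : Stage7Numerics) (g : ℕ → ℝ) {m : ℕ} (hm1 : 1 ≤ m) {δ N' B Λ γ : ℝ} (hδ : 0 < δ) (hN : 0 < N')
    (hB : 0 < B) (hA0 : 0 < ν.A₀) (hp0 : 1 ≤ ν.p₀) (hX : 0 ≤ 4 * N' * B ^ 2 * (Λ + Real.log m / δ)) (j : ℕ)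
    (hg : 0 < g (j + 1)) (hle : g (j + 1) ≤ γ)
    (hlog : (4 * N' * B ^ 2 * (Λ + Real.log m / δ) / ν.A₀ ^ 2) ^ ((1 : ℝ) / (2 * ν.p₀)) ≤ Real.log (γ ^ 2)⁻¹) (n : ℕ) :
    Real.log (((m : ℝ) * Real.exp (Λ * δ - δ * ((g (j + 1)) ^ 2)⁻¹ * ((epsOfRecord ν g (j + 1) / B) ^ 2 / (2 * N')))) ^ n) ≤
      -(δ * (Λ + Real.log m / δ)) * n := by
  have hm1' : (1 : ℝ) ≤ m := by exact_mod_cast hm1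
  have hpos : 0 < ((m : ℝ) * Real.exp (Λ * δ - δ * ((g (j + 1)) ^ 2)⁻¹ * ((epsOfRecord ν g (j + 1) / B) ^ 2 / (2 * N')))) ^ n :=
    pow_pos (mul_pos (lt_of_lt_of_le one_pos hm1') (Real.exp_pos _)) _
  have h47 := rate_pow_le_of_coupling_le ν g (j + 1) hm1' hδ hN hB hA0 hp0 hX hg hle hlog n
  rw [threshold_div_eq hN hB] at h47
  calc Real.log (((m : ℝ) * Real.exp (Λ * δ - δ * ((g (j + 1)) ^ 2)⁻¹ * ((epsOfRecord ν g (j + 1) / B) ^ 2 / (2 * N')))) ^ n)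
      ≤ Real.log (Real.exp (-(δ * (Λ + Real.log m / δ)) * n)) := Real.log_le_log hpos h47
    _ = -(δ * (Λ + Real.log m / δ)) * n := Real.log_exp _

end Halves

end Summit.QuantumFields.YangMills.BalabanUVNodes.N20LCSInstanceModuloTwo

end
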